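import Summits.Ventures.HodgeRepro.DihedralQuadLocal

/-!
# The dihedral rectangle: no pair of twists is conjugate on both local patterns

Blind re-derivation cell `pub-hodge-repro`, seat `p1` (gen 11).  The third hypothesis of `exists_quad_of_pattern`
for the dihedral rectangle (`DihedralQuadLocal.lean`): for every pair `(i, j)` of twists there is a label `l` and a
point `p` of `D_{2k}` at which `χ_l(p tⱼ⁻¹) ≠ χ_l(p c tᵢ⁻¹)`.  The diagonal `i = j` is the CM condition itself
(`χ(q c) = ¬χ(q)`); for `i ≠ j` the translate `tⱼ c tᵢ⁻¹` runs through `sc, tc, rc, r⁻¹c, (rs)c`: pattern `β`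
(`[a odd]`) is NOT invariant under `sc` (the parity of `k` flips it), pattern `α` (`[k ≤ a]`) is not invariant
under the other four — one explicit point each, at `p = r 0` or `p = r 1`, with the values
`0, 1, k, k ± 1, 2k − 1` of the indices read off in `ℤ/2k` (`k ≥ 3`).
-/

set_option autoImplicit false

open Finset DihedralGroup
open scoped Pointwise

namespace HodgeRepro.CosetQuad

section DihedralNoConj

variable (k : ℕ) [NeZero k]

omit [NeZero k] in
/-- `(1 − k : ℤ/2k).val = k + 1` for `k ≥ 2`. -/
theorem val_one_sub_K (hk : 2 ≤ k) : ((1 : ZMod (2 * k)) - ((k : ℕ) : ZMod (2 * k))).val = k + 1 := by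
  rw [one_sub_K, ZMod.val_natCast]
  exact Nat.mod_eq_of_lt (by omega)

/-- `(k − 1 : ℤ/2k).val = k − 1`. -/
theorem val_K_sub_one : (((k : ℕ) : ZMod (2 * k)) - 1).val = k - 1 := by
  rw [K_sub_one, ZMod.val_natCast]
  exact Nat.mod_eq_of_lt (by have := NeZero.ne k; omega)

omit [NeZero k] in
/-- `(1 + k : ℤ/2k).val = k + 1` for `k ≥ 2`. -/
theorem val_one_add_K (hk : 2 ≤ k) : ((1 : ZMod (2 * k)) + ((k : ℕ) : ZMod (2 * k))).val = k + 1 := by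
  rw [one_add_K, ZMod.val_natCast]
  exact Nat.mod_eq_of_lt (by omega)

omit [NeZero k] in
/-- `r a · (c (t i)⁻¹) = r (a + k) · (t i)⁻¹`. -/
theorem r_mul_conjD_twistD_inv (a : ZMod (2 * k)) (i : Fin 4) :
    r a * (conjD k * (twistD k i)⁻¹) = r (a + (k : ZMod (2 * k))) * (twistD k i)⁻¹ := by
  rw [← mul_assoc, conjD, r_mul_r]

omit [NeZero k] in
/-- `(!decide P) = true ↔ ¬ P`. -/
theorem not_decide_eq_true_iff {P : Prop} [Decidable P] : (!decide P) = true ↔ ¬ P := by simp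

omit [NeZero k] in
/-- `decide P = true ↔ P`, restated for `simp only`. -/
theorem decide_eq_true_iff' {P : Prop} [Decidable P] : decide P = true ↔ P := decide_eq_true_iff

/-- The diagonal: no twist is conjugate to itself (the CM condition at `p = tᵢ`). -/
theorem patternD_noConj_diag (hk : 3 ≤ k) (i : Fin 4) :
    ¬ ∀ l p, (patternD k l (p * (twistD k i)⁻¹) = true ↔
      patternD k l (p * (conjD k * (twistD k i)⁻¹)) = true) := by
  intro h
  have h1 := h 0 (twistD k i)
  have e2 : twistD k i * (conjD k * (twistD k i)⁻¹) = conjD k := by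
    rw [← mul_assoc, mul_conjD_comm, mul_assoc, mul_inv_cancel, mul_one]
  rw [mul_inv_cancel, e2, patternD_zero, patternD_zero, one_def, conjD] at h1
  simp only [patA, ZMod.val_zero, val_K, decide_eq_true_iff'] at h1
  omega

/-- **No conjugate pair on both patterns** for every pair of twists. -/
theorem patternD_noConj (hk : 3 ≤ k) (hodd : Odd k) : ∀ i j : Fin 4,
    ¬ ∀ l p, (patternD k l (p * (twistD k j)⁻¹) = true ↔
      patternD k l (p * (conjD k * (twistD k i)⁻¹)) = true) := by
  have hk1 : k % 2 = 1 := Nat.odd_iff.mp hodd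
  have hK := val_K k
  have h0 : ((0 : ZMod (2 * k))).val = 0 := ZMod.val_zero
  have h1 := val_one' k
  have hm1 := val_neg_one' k
  have h1K := val_one_sub_K k (by omega)
  have hK1 := val_K_sub_one k
  have h1pK := val_one_add_K k (by omega)
  have hnK := neg_K k
  have hfin : ∀ i : Fin 4, i = 0 ∨ i = 1 ∨ i = 2 ∨ i = 3 := by decide
  intro i j
  rcases hfin i with rfl | rfl | rfl | rfl <;> rcases hfin j with rfl | rfl | rfl | rfl
  -- (0,0)
  · exact patternD_noConj_diag k hk 0
  -- (0,1): β at r 0 — `sr 0` vs `r k`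
  · intro h
    have := h 1 (r 0)
    rw [r_mul_conjD_twistD_inv, zero_add, (r_mul_twistD_inv k 0).2.1, (r_mul_twistD_inv k _).1,
      neg_zero, patternD_one, patternD_one] at this
    simp only [patB, h0, hK, decide_eq_true_iff', Nat.odd_iff] at this
    omega
  -- (0,2): α at r 0 — `sr 1` vs `r k`
  · intro h
    have := h 0 (r 0)
    rw [r_mul_conjD_twistD_inv, zero_add, (r_mul_twistD_inv k 0).2.2.1, (r_mul_twistD_inv k _).1,
      sub_zero, patternD_zero, patternD_zero] at this
    simp only [patA, hm1, hK, decide_eq_true_iff', not_decide_eq_true_iff] at this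
    omega
  -- (0,3): α at r 1 — `r 0` vs `r (1 + k)`
  · intro h
    have := h 0 (r 1)
    rw [r_mul_conjD_twistD_inv, (r_mul_twistD_inv k 1).2.2.2, (r_mul_twistD_inv k _).1,
      sub_self, patternD_zero, patternD_zero] at this
    simp only [patA, h0, h1pK, decide_eq_true_iff'] at this
    omega
  -- (1,0): β at r 0 — `r 0` vs `sr (−k) = sr k`
  · intro h
    have := h 1 (r 0)
    rw [r_mul_conjD_twistD_inv, zero_add, (r_mul_twistD_inv k 0).1, (r_mul_twistD_inv k _).2.1,
      hnK, patternD_one, patternD_one] at this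
    simp only [patB, h0, hK, decide_eq_true_iff', Nat.odd_iff] at this
    omega
  -- (1,1)
  · exact patternD_noConj_diag k hk 1
  -- (1,2): α at r 1 — `sr 0` vs `sr (−(1 + k))`
  · intro h
    have := h 0 (r 1)
    rw [r_mul_conjD_twistD_inv, (r_mul_twistD_inv k 1).2.2.1, (r_mul_twistD_inv k _).2.1,
      sub_self, patternD_zero, patternD_zero] at this
    simp only [patA, neg_zero, neg_neg, h0, h1pK, not_decide_eq_true_iff] at this
    omega
  -- (1,3): α at r 0 — `r (−1)` vs `sr (−k)`
  · intro h
    have := h 0 (r 0)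
    rw [r_mul_conjD_twistD_inv, zero_add, (r_mul_twistD_inv k 0).2.2.2, (r_mul_twistD_inv k _).2.1,
      zero_sub, patternD_zero, patternD_zero] at this
    simp only [patA, neg_neg, hm1, hK, decide_eq_true_iff', not_decide_eq_true_iff] at this
    omega
  -- (2,0): α at r 0 — `r 0` vs `sr (1 − k)`
  · intro h
    have := h 0 (r 0)
    rw [r_mul_conjD_twistD_inv, zero_add, (r_mul_twistD_inv k 0).1, (r_mul_twistD_inv k _).2.2.1,
      patternD_zero, patternD_zero] at this
    simp only [patA, neg_sub, h0, hK1, decide_eq_true_iff', not_decide_eq_true_iff] at this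
    omega
  -- (2,1): α at r 1 — `sr (−1)` vs `sr (1 − (1 + k)) = sr (−k)`
  · intro h
    have := h 0 (r 1)
    rw [r_mul_conjD_twistD_inv, (r_mul_twistD_inv k 1).2.1, (r_mul_twistD_inv k _).2.2.1,
      sub_add_cancel_left, patternD_zero, patternD_zero] at this
    simp only [patA, neg_neg, h1, hK, not_decide_eq_true_iff] at this
    omega
  -- (2,2)
  · exact patternD_noConj_diag k hk 2
  -- (2,3): β at r 0 — `r (−1)` vs `sr (1 − k)`
  · intro h
    have := h 1 (r 0)
    rw [r_mul_conjD_twistD_inv, zero_add, (r_mul_twistD_inv k 0).2.2.2, (r_mul_twistD_inv k _).2.2.1,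
      zero_sub, patternD_one, patternD_one] at this
    simp only [patB, hm1, h1K, decide_eq_true_iff', Nat.odd_iff] at this
    omega
  -- (3,0): α at r 1 — `r 1` vs `r (1 + k − 1) = r k`
  · intro h
    have := h 0 (r 1)
    rw [r_mul_conjD_twistD_inv, (r_mul_twistD_inv k 1).1, (r_mul_twistD_inv k _).2.2.2,
      add_sub_cancel_left, patternD_zero, patternD_zero] at this
    simp only [patA, h1, hK, decide_eq_true_iff'] at this
    omega
  -- (3,1): α at r 0 — `sr 0` vs `r (k − 1)`
  · intro h
    have := h 0 (r 0)
    rw [r_mul_conjD_twistD_inv, zero_add, (r_mul_twistD_inv k 0).2.1, (r_mul_twistD_inv k _).2.2.2,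
      neg_zero, patternD_zero, patternD_zero] at this
    simp only [patA, neg_zero, h0, hK1, decide_eq_true_iff', not_decide_eq_true_iff] at this
    omega
  -- (3,2): β at r 0 — `sr 1` vs `r (k − 1)`
  · intro h
    have := h 1 (r 0)
    rw [r_mul_conjD_twistD_inv, zero_add, (r_mul_twistD_inv k 0).2.2.1, (r_mul_twistD_inv k _).2.2.2,
      sub_zero, patternD_one, patternD_one] at this
    simp only [patB, h1, hK1, decide_eq_true_iff'] at this
    have h2 : Odd (k - 1) := this.mp odd_one
    rw [Nat.odd_iff] at h2
    omega
  -- (3,3)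
  · exact patternD_noConj_diag k hk 3

end DihedralNoConj

end HodgeRepro.CosetQuad
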